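import Literature.MathematicalPhysics.QuantumLattice.SchwartzKernelTheorem
import Literature.MathematicalPhysics.QuantumLattice.SchwingerOSCluster
import HarnessLib

/-!
# From OS measures to OS Schwinger families: discharge of `IsOSMeasure.exists_isOSFamily`

Trunk **T-AQFT** (topic `MathematicalPhysics/QuantumLattice`), families `constructive-qft`,
`crit-ising`; the proofs file of `SchwingerOSAxioms`, closing the decomposition of the bridge
"measure-form OS axioms ⇒ distributional OS axioms".

Discharged named facts:

* `Literature.MathematicalPhysics.QuantumLattice.IsSchwingerFamilyOf.isOSReflectionPositive` (`SchwingerOSAxioms`; Glimm–Jaffe §6.1,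
  (6.1.8) and Prop. 6.1.4; OS 1973 §3 (E2)): the Schwinger family of a probability law with OS0
  and OS3 is reflection positive — `IsSchwingerFamilyOf.isOSReflectionPositive_holds`, combining
  the reduction to the density of positive-time tensor products
  (`IsSchwingerFamilyOf.isOSReflectionPositive_of_closure`, `SchwingerOSPositivity`) with that
  density (`IsPositiveTimeMulti.mem_closure_span_positiveTensorProducts_holds`,
  `SchwartzTensorDensityProofs`).
* `Literature.MathematicalPhysics.QuantumLattice.IsOSMeasure.exists_isOSFamily` (`SchwingerOSAxioms`; Glimm–Jaffe §6.1, Prop. 6.1.4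
  and Thm 6.1.5, §19.7 Thm 19.7.1; Osterwalder–Schrader 1973 §3): if `μ` satisfies the
  measure-form axioms OS0–OS4 on `𝒮'(ℝ^d)` and its moment functionals are jointly continuous,
  then its Schwinger functions exist and satisfy `𝔖₀ = 1`, E1–E4 —
  `IsOSMeasure.exists_isOSFamily_holds`, the assembly `IsOSMeasure.exists_isOSFamily_of` fed with
  the discharges of its five inputs: the kernel theorem (`existsUnique_schwingerFamilyOf_holds`,
  `SchwartzKernelTheorem`), E1 and E3 (`IsSchwingerFamilyOf.isEuclideanCovariant_holds`,
  `IsSchwingerFamilyOf.isSymmetric_holds`, `SchwartzTensorDensityProofs`), E2 (above) and E4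
  (`IsSchwingerFamilyOf.hasClusterProperty_holds`, `SchwingerOSCluster`).

* `Literature.MathematicalPhysics.QuantumLattice.SchwingerFamily.IsOSReflectionPositive.single` (`SchwingerOSAxioms`;
  Osterwalder–Schrader 1973 §3 (E2), p. 88, and §4.1 (4.3), p. 91): E2 for a sequence
  concentrated in one degree, `𝔖₂ₙ(ΘF* ⊗ F) ≥ 0` for positive-time `F` —
  `SchwingerFamily.IsOSReflectionPositive.single_holds`, (E2) applied to the one-term sequence
  `(0, …, 0, F, 0, …)`, the double sum collapsing to its single nonzero term.

(The joint continuity hypothesis of the bridge is itself a consequence of OS0–OS1,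
`IsOSMeasure.continuous_moment` of `OSMomentBounds`, Glimm–Jaffe Prop. 19.1.1.)

## Sources

* J. Glimm, A. Jaffe, *Quantum Physics. A Functional Integral Point of View* (2nd ed., 1987),
  §6.1 (Prop. 6.1.4, Thm 6.1.5) and §19.7 (Thm 19.7.1). [GlimmJaffeQP1987]
* K. Osterwalder, R. Schrader, *Axioms for Euclidean Green's functions*, Comm. Math. Phys. 31
  (1973) 83–112, §3. [OsterwalderSchraderCMP1973]
-/

noncomputable section

namespace Literature.MathematicalPhysics.QuantumLattice

variable {d : ℕ} [NeZero d]

/-- **Discharge of `IsSchwingerFamilyOf.isOSReflectionPositive`** (E2 for the Schwinger functions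
of a probability law with OS0 and OS3; Glimm–Jaffe §6.1, (6.1.8) and Prop. 6.1.4; OS 1973 §3):
the reduction `isOSReflectionPositive_of_closure` to the density of positive-time tensor products,
fed with that density, `IsPositiveTimeMulti.mem_closure_span_positiveTensorProducts_holds`. [cite: GlimmJaffeQP1987, §6.1 (6.1.8) and Prop. 6.1.4] -/
theorem IsSchwingerFamilyOf.isOSReflectionPositive_holds :
    IsSchwingerFamilyOf.isOSReflectionPositive (d := d) :=
  IsSchwingerFamilyOf.isOSReflectionPositive_of_closure
    IsPositiveTimeMulti.mem_closure_span_positiveTensorProducts_holds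

/-- **Discharge of `IsOSMeasure.exists_isOSFamily`** (from OS measures to OS Schwinger families;
Glimm–Jaffe §6.1, Prop. 6.1.4 and Thm 6.1.5, with Thm 19.7.1 for E4; Osterwalder–Schrader 1973
§3): a law `μ` on `𝒮'(ℝ^d)` with OS0–OS4 and jointly continuous moment functionals has Schwinger
functions `𝔖ₙ ∈ 𝒮'(ℝ^{dn})`, `𝔖ₙ(f₁ ⊗ ⋯ ⊗ fₙ) = ∫ ∏ᵢ ω(fᵢ) dμ`, satisfying `𝔖₀ = 1` and E1–E4.
The assembly `IsOSMeasure.exists_isOSFamily_of` applied to the discharges of its inputs: the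
Schwartz kernel theorem (`existsUnique_schwingerFamilyOf_holds`), E1
(`IsSchwingerFamilyOf.isEuclideanCovariant_holds`), E2
(`IsSchwingerFamilyOf.isOSReflectionPositive_holds`), E3 (`IsSchwingerFamilyOf.isSymmetric_holds`)
and E4 (`IsSchwingerFamilyOf.hasClusterProperty_holds`). [cite: GlimmJaffeQP1987, §6.1 Thm 6.1.5] -/
theorem IsOSMeasure.exists_isOSFamily_holds : IsOSMeasure.exists_isOSFamily (d := d) :=
  IsOSMeasure.exists_isOSFamily_of existsUnique_schwingerFamilyOf_holds
    IsSchwingerFamilyOf.isEuclideanCovariant_holds IsSchwingerFamilyOf.isOSReflectionPositive_holds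
    IsSchwingerFamilyOf.isSymmetric_holds IsSchwingerFamilyOf.hasClusterProperty_holds

/-! ### E2 in a single degree: discharge of `SchwingerFamily.IsOSReflectionPositive.single` -/

section Single

open scoped SchwartzMap

/-- **Discharge of `IsOSReflectionPositive.single`** (Osterwalder–Schrader, CMP 31 (1973), §3,
axiom (E2), p. 88: `∑ₙₘ 𝔖ₙ₊ₘ(Θfₙ* × fₘ) ≥ 0` for every finite sequence `f ∈ 𝒮₊`; §4.1 (4.3),
p. 91, the positive semidefinite form `(f, g)`). Apply (E2) to the one-term sequence
`(0, …, 0, F, 0, …)` concentrated in degree `n` (`Function.update 0 n F`), with witnesses `H` in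
bidegree `(n, n)` and `0` elsewhere (a tensor product with a zero factor vanishes); the double
sum over `range (n + 1)²` collapses to its single surviving term `𝔖₂ₙ(ΘF* ⊗ F)`. [cite: OsterwalderSchraderCMP1973, §3 (E2) p. 88 and §4.1 (4.3) p. 91] -/
theorem SchwingerFamily.IsOSReflectionPositive.single_holds :
    SchwingerFamily.IsOSReflectionPositive.single (d := d) := by
  intro S hS n F hF H hH
  -- the one-term sequence `(0, …, 0, F, 0, …)` and its tensor-product witnesses
  let sq : (m : ℕ) → 𝓢((Fin m → EuclideanSpace ℝ (Fin d)), ℂ) := Function.update 0 n F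
  let W : (a b : ℕ) → 𝓢((Fin (a + b) → EuclideanSpace ℝ (Fin d)), ℂ) :=
    Function.update 0 n (Function.update 0 n H)
  have hsq_n : sq n = F := by simp [sq]
  have hsq_ne : ∀ {m : ℕ}, m ≠ n → sq m = 0 := fun hmn => by simp [sq, hmn]
  have hW_nn : W n n = H := by simp [W]
  have hW_left : ∀ {a : ℕ} (b : ℕ), a ≠ n → W a b = 0 := fun b ha => by simp [W, ha]
  have hW_right : ∀ (a : ℕ) {b : ℕ}, b ≠ n → W a b = 0 := fun a b hb => by
    rcases eq_or_ne a n with rfl | ha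
    · simp [W, hb]
    · simp [W, ha]
  have hzero : ∀ m : ℕ, IsPositiveTimeMulti (0 : 𝓢((Fin m → EuclideanSpace ℝ (Fin d)), ℂ)) :=
    fun m x hx => by rw [FunLike.coe_zero, tsupport_zero] at hx; simp at hx
  have hE2 := hS n sq (fun m hm => hsq_ne hm.ne')
    (fun m => by
      rcases eq_or_ne m n with hm | hm
      · rw [hm, hsq_n]; exact hF
      · rw [hsq_ne hm]; exact hzero m)
    W
    (fun a b => by
      rcases eq_or_ne a n with ha | ha
      · rcases eq_or_ne b n with hb | hb
        · subst ha hb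
          rw [hW_nn, hsq_n]; exact hH
        · rw [hW_right a hb, hsq_ne hb]; intro x; simp
      · rw [hW_left b ha, hsq_ne ha]; intro x; simp)
  -- collapse the double sum to its single surviving term
  have hn : n ∈ Finset.range (n + 1) := Finset.self_mem_range_succ n
  have hsum : ∑ a ∈ Finset.range (n + 1), ∑ b ∈ Finset.range (n + 1), S (a + b) (W a b) =
      S (n + n) H := by
    rw [Finset.sum_eq_single_of_mem n hn fun a _ ha =>
        Finset.sum_eq_zero fun b _ => by rw [hW_left b ha, map_zero],
      Finset.sum_eq_single_of_mem n hn fun b _ hb => by rw [hW_right n hb, map_zero], hW_nn]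
  obtain ⟨hre, him⟩ := hE2
  rw [hsum] at hre him
  exact ⟨hre, him⟩

end Single

end Literature.MathematicalPhysics.QuantumLattice
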